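import Mathlib
import HarnessLib
import HarnessLib.Audit
import Summits.AtomisticToContinuum.Statement

/-!
Route: StiffRelaxation

CLOSED (retired) 2026-08-15T13:47:05Z by operator:999:1257524 — reason: not-a-thesis: assembly does not conclude the sub-problem Statement — note: D-0027 §2.1 audit (human 2026-08-15: routes that do not decide the summit are removed): the assembly concludes `Literature.MathematicalPhysics.KineticTheory.HydrodynamicLimit`, not the sub-problem statement; a NEW conforming route may be opened from the same idea (generated `closes : … → _root_.Hydr. The file is kept as the record of this route; refuted decls are indexed as negative knowledge (`ledger negatives`).

# Route StiffRelaxation — stiff relaxation of the exact N-body moment hierarchy — one-sided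
collisional coercivity plus macroscopic relative entropy gives Euler before shocks

It suffices to show X = X_micro ∧ X_pde (realising idea card
stiff-relaxation-collisional-coercivity; the statics inputs MesoscopicLLN, HsEntropyUniformlyConvex,
HsFreeEnergyConvex and the shared loophole NoImplosion ride as support). All block fields are kernel
averages Ū_N = (ρ̄, m̄, Ē)(s, x) = ⟨empirical measure of Φ_s z, φ_N(· − x) ⊗ (1, v, |v|²/2)⟩ at a
mesoscopic scale (N+1)^(−γ), 0 < γ ≤ 1/15, under the local Gibbs law at reduced density σ < σ₀, ν_N
= (N+1)^(1/3) the collision clock.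
X_micro: (K1) CollisionalCoercivity — the STIFF DISSIPATION INEQUALITY κν_N ∫₀ᵗ∫|D|² + ½∫|D(t)|² ≤
½∫|D(0)|² + ∫₀ᵗ∫⟨D, T_free D⟩ + o(1) in probability for the block traceless central kinetic stress
D, and the same for the block kinetic heat flux q (T_free = derivative along free flight; the
missing term is exactly the collisional production, so this says collisions destroy fast moments at
rate ≥ κν_N with ONE constant κ > 0 and no velocity law identified); (K2)
CollisionalTransferLocality — the collisional momentum / energy transfer, DEFINED as the exact
residual of the ψ- resp. χ-tested balance law after time-derivative and free-transport terms, equals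
∫₀^τ∫ div ψ · p_c(ρ̄, θ̄) resp. ∫₀^τ∫ ∇χ·ū p_c(ρ̄, θ̄) up to o(1) uniformly in τ ≤ t, with p_c(ρ, θ)
= hsPressure σ ρ θ − ρθ; (K3) AprioriBounds — a time-averaged ONE-particle exponential velocity
moment is bounded and the block density stays in [c₁, σ⁻³] w.h.p.; (K4) SecondLawInProbability — the
block thermodynamic entropy −∫η_σ(Ū_N(τ)) never drops below its initial value by δ, w.h.p. uniformly
in τ ≤ t.
X_pde: RelEntropyStability — Dafermos/DiPerna/Tzavaras relative-entropy stability of a classical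
hs-Euler solution on 𝕋³ against ANY bounded measurable field with small initial relative entropy,
approximate GLOBAL entropy inequality, small weak residual tested against Λ = Dη_σ(U_cl), and an
exponentially small hot-cell functional; conclusion in L¹.
Lean: `CollisionalCoercivity ∧ CollisionalTransferLocality ∧ AprioriBounds ∧ SecondLawInProbability
∧ RelEntropyStability`

## Assembly
Glue (measure theory + bookkeeping, no new idea; planner-checked that every hypothesis of
RelEntropyStability is produced): fix profiles; σ₀ := min of the items' σ₀, shrunk so that 2Rσ₀³ <
η₀ (R from NoImplosion, η₀ from HsEntropyUniformlyConvex); fix σ, T, the solution, Φ, the t = 0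
hypothesis, t < T; choose γ = 1/15 and an admissible kernel family (smooth torus bumps b∘reprSym, a
provable construction); MesoscopicLLN + the t = 0 hypothesis identify (ρ₀, u₀, θ₀) = (ρ, u, θ)(0)
(weak limits are unique under probability laws) and give ∫h(Ū(0)|U_cl(0)) → 0 in probability; on the
intersection G_N of the good events of CoercivityGlue(K1, K3) = FastMomentRelaxation,
CollisionalTransferLocality (ψ = Λ_m, χ = Λ_E, uniform in τ), AprioriBounds (chamber + hot-cell
functional via the cell-level Chebyshev bound E^(3/2)ρ^(−1/2) ≤ C√M e^(−λM/2)·⟨φ e^(λ|v|²)⟩ on {E >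
Mρ}) and SecondLawInProbability, the block field U of the trajectory satisfies every hypothesis of
RelEntropyStability (the weak residual splits EXACTLY into the kinetic defects ∂Λ_m:D + ∂Λ_E·(Dū +
q), small by FastMomentRelaxation and ∫|ū|² ≤ 2E_tot/c₁, and the two collisional residuals of K2),
hence ∫ₓ|Ū(t) − U_cl(t)| ≤ ε on G_N with P(G_Nᶜ) → 0; finally χ continuous ⇒ |∫χ dfield −
∫(χ∗φ̌_N)ρ̄| → 0 uniformly, so TendstoHydroFieldsAt holds at t. EOS regularity/convexity hypotheses
come from HsEntropyUniformlyConvex and HsFreeEnergyConvex (NoImplosion keeps U_cl in the chamber).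

Rationale: WHY THIS LINE. Read the deterministic hard-sphere gas as a STIFF HYPERBOLIC RELAXATION SYSTEM
(ChenLevermoreLiu1994): the Irving–Kirkwood moment hierarchy of the N-body flow is EXACT
(IrvingKirkwood1950; Spohn1991 Part I (3.6)–(3.8)), its slow part is (ρ̄, m̄, Ē), its fast part W =
(D, q) obeys an exact balance "free transport + collisional production" with production of size ν_N
= (N+1)^(1/3) → ∞, and realizability / psd-ness of the total stress are identities (Levermore1996),
so the only closure input asked of the microscopic dynamics is ONE-SIDED: collisions are a sink for
W (K1, the card's coercivity; for Maxwell molecules the production of the pressure deviator is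
exactly −νP°, IkenberryTruesdell1956; the Enskog-level collisional source of the second moment is
computed in Chou2001) plus locality of the contact rate (K2, shared with card
limit-collision-measure-chaos crux 2). The macroscopic half imports hyperbolic-PDE stability theory:
relative entropy against a Lipschitz solution with the defect flux as forcing (Dafermos1979;
Dafermos2005 Thm 5.2.1; Tzavaras2005; BerthelinVasseur2005 and BerthelinTzavarasVasseur2009 derive
multi-d Euler before shocks from kinetic relaxation models exactly this way), run here with LOCAL
energy balance and only the GLOBAL entropy inequality, which on 𝕋³ is free from Liouville invariance
of the global Gibbs law plus large-deviation statics (K4) — no local-equilibrium closure, no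
classification of stationary states, no kinetic equation, no density expansion. What the line does
that the five existing routes do not: RelEntropyErgodic/ChaoticMixing/VanishingNoise need Gibbs
ergodicity or noise (BoltzmannHypothesis barrier), DenseKineticExpansion needs a convergent dense
cumulant expansion, DissipativeWeakStrong asks full weak flux closure + a local second law for
Young-measure limits; here the microscopic input shrinks to a dissipation INEQUALITY with one
constant and a contact-rate locality, both typed, and the price is paid openly in AprioriBounds
(HighMomentumCutoff barrier) and in the dilute-chamber bookkeeping (NoImplosion).

RANKED CRUXES. #2 CollisionalCoercivity (crux) — (card K1, typed as the stiff dissipation inequality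
(‡)) for all continuous profiles ∃σ₀ ∀σ<σ₀ ∀ flows ∀γ∈(0,1/15] ∀ admissible kernel families φ_N
(smooth, ≥ 0, ∫φ_N = 1, supported in the ball of radius (N+1)^(−γ), φ_N ≤ C(N+1)^(3γ), |∇φ_N| ≤
C(N+1)^(4γ)) ∀t>0 ∃κ>0 ∀δ>0: with probability → 1 under localGibbsLaw, BOTH κ(N+1)^(1/3)∫₀ᵗ∫ₓ|D|² +
½∫ₓ|D(t)|² ≤ ½∫ₓ|D(0)|² + ∫₀ᵗ∫ₓ⟨D, T_free D⟩ + δ AND the same inequality for q, where D(x) =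
traceless part of ∫φ_N(y−x)(v−ū(x))⊗(v−ū(x)) dμ_N (block central kinetic stress), q(x) =
∫φ_N(y−x)|v−ū|²(v−ū)/2 dμ_N (block kinetic heat flux), ū = m̄/ρ̄, T_free O(z) = d/dτ O(freeFlight τ
z) at τ = 0; intended proof = angular Doeblin minorisation of the collision normal + partner
diversity on the |g|-weighted collision multigraph + concentration of the collision martingale (jump
noise N^(3γ−2/3), fluctuation N^(9γ−2/3) → 0 for γ ≤ 1/15). [difficulty: XL] (why it might fail: κ
must be uniform over cold/dilute cells and adversarial pairings; angular Doeblin minorisation alone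
cannot contract anisotropy along an adversarial direction (partner diversity is load-bearing); the
q-part couples to quartic moments; no collisional coercivity is proved for any N-body flow.)
[ChenLevermoreLiu1994, IkenberryTruesdell1956, Chou2001, Grad1949, ChapmanCowling1970,
Levermore1996]
#3 CollisionalTransferLocality (crux) — (card K2) for all profiles ∃σ₀ ∀σ<σ₀ ∀ flows ∀ admissible
kernels ∀t>0 ∀ smooth space–time test fields ψ (V3-valued), χ (scalar) on [0,t] ∀δ>0: with
probability → 1, for ALL τ ≤ t, |Cc(τ) − ∫₀^τ∫ₓ (div ψ + ∇χ·ū) p_c(ρ̄, θ̄)| ≤ δ, where Cc(τ) = [⟨μ,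
ψ·v + χ|v|²/2⟩]₀^τ − ∫₀^τ(⟨μ, ∂_sψ·v + ∂_sχ|v|²/2⟩ + T_free⟨μ, ψ·v + χ|v|²/2⟩) ds is BY DEFINITION
the collisional momentum-plus-energy transfer tested against (ψ, χ) (the exact Irving–Kirkwood
residual of the tested balance laws after the time-derivative and free-transport terms; χ = 0 resp.
ψ = 0 give the momentum resp. energy statements), p_c(ρ, θ) = hsPressure σ ρ θ − ρθ = ρθ(Z(ρσ³) − 1)
is the collisional pressure, ū = m̄/ρ̄ and θ̄ = (2/3)(Ē/ρ̄ − |m̄|²/(2ρ̄²)); i.e. the line-averaged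
collisional stress is isotropic and a local function of the block fields, the collisional energy
flux is p_c ū, and there is no collisional heat flux at leading order. [difficulty: L] (why it might
fail: contact pair statistics (rate × transfer) are two-body quantities collisions do not relax: out
of equilibrium the contact value and isotropy of g₂ could lag the block fields beyond o(1); `deriv`
junk in Z(η) off the analytic region bites if dense mesoscopic clusters have positive probability.)
[Spohn1991, IrvingKirkwood1950, ChapmanCowling1970, Resibois1978, Chou2001]
#4 AprioriBounds (crux) — (card K4 strengthened to what the glue provably needs) for all profiles
∃σ₀ ∀σ<σ₀ ∀ flows ∀t>0: (i) ∃λ>0, C: with probability → 1, ∫₀ᵗ (N+1)⁻¹Σᵢ exp(λ|vᵢ(s)|²) ds ≤ C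
(time-averaged ONE-particle exponential velocity moment; order one, not order N); (ii) for every
admissible kernel family ∃c₁>0: with probability → 1, for all s ≤ t and all x, c₁ ≤ ρ̄(s,x) and
ρ̄(s,x)σ³ ≤ 1 (no empty and no jammed mesoscopic cell; 1 < √2 = close packing keeps
hsExcessFreeEnergy junk-free). [difficulty: L] (why it might fail: no dynamical velocity-tail or
anti-clustering estimate is known for hard spheres at fixed density (OVY had to modify the kinetic
energy — HighMomentumCutoff barrier); particles of speed ≫ √log N, or one empty/jammed cell of side
N^(−γ) before time t with non-vanishing probability, break it.) [OllaVaradhanYau1993, Alexander1975,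
GST2013, Spohn1991]
#5 RelEntropyStability (crux) — (card K3, the PDE half, deterministic) for σ, η₀, c₁, λ, C > 0 with
hsExcessFreeEnergy C² on (0, η₀), η_σ = −ρs strongly convex (modulus m(E₁) > 0) on each chamber
{c₁/2 < ρ, ρσ³ < η₀, |m|² < 2ρE, E < E₁} and convex on {0 < ρ, ρσ³ < 11/10, |m|² < 2ρE}, every
classical hs-Euler solution U_cl = (ρ, ρu, E) on [0,T) with c₁ ≤ ρ and 2ρσ³ < η₀, every t₁ < T and ε
> 0 admit δ > 0 such that every bounded jointly measurable field U : ℝ → 𝕋³ → ℝ×V3×ℝ, continuous in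
x, with values in {c₁ ≤ ρ, ρσ³ ≤ 1, |m|² < 2ρE} on [0,t₁], initial relative entropy ∫h(U(0)|U_cl(0))
≤ δ, approximate global entropy inequality ∫η_σ(U(τ)) ≤ ∫η_σ(U(0)) + δ (τ ≤ t₁), hot-cell functional
∫₀^t₁∫ 1(E > Mρ)(E^(3/2)ρ^(−1/2) + E + ρ) ≤ C e^(−λM) for all M ≥ 1, and weak residual |[∫Λ·U]₀^τ −
∫₀^τ∫(∂_sΛ·U + Σ_j ∂_jΛ·F_j(U))| ≤ δ (τ ≤ t₁) against Λ = Dη_σ(U_cl) with the hs-Euler fluxes F_j,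
satisfies ∫ₓ(|ρ̄−ρ| + |m̄−ρu| + |Ē−E|)(τ) ≤ ε for all τ ≤ t₁ (Dafermos 5.2.14 on 𝕋³ with the defect
as forcing, Gronwall on {E ≤ Mρ} with constant e^(C√M t) beaten by e^(−λM), linear growth of h on
dense/hot cells). [difficulty: L] (why it might fail: the energy flux is cubic in velocity while
relative entropy is quadratic: the Gronwall constant grows like e^(C√M·t) on {E ≤ Mρ} and must be
beaten by the e^(−λM) hot-cell allowance, and dense cells rely on mere convexity up to ρσ³ = 1.1 — a
gap in either trade-off falsifies the stated δ-uniformity.) [Dafermos1979, Dafermos2005,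
Tzavaras2005, BerthelinVasseur2005, BerthelinTzavarasVasseur2009, BrezinaFeireisl2018]
#6 SecondLawInProbability (crux) — (card "free input (ii)" of invariant-gibbs-entropy-bookkeeping,
made a crux) for all profiles ∃σ₀ ∀σ<σ₀ ∀ flows ∀ admissible kernels ∀t>0 ∀δ>0: with probability → 1
under localGibbsLaw, for ALL τ ≤ t, ∫ₓ η_σ(Ū_N(τ, x)) dx ≤ ∫ₓ η_σ(Ū_N(0, x)) dx + δ, with η_σ(ρ, m,
E) = −ρ(3/2 log θ − log ρ − hsExcessFreeEnergy(ρσ³)), θ = (2/3)(E/ρ − |m|²/(2ρ²)) (the entropy of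
stmt-0817); intended proof: relative entropy w.r.t. the INVARIANT global Gibbs law G is conserved,
dP_t/dG = (dP₀/dG)∘Φ_(−t) is an exponential of a linear empirical functional of conserved type,
Hölder with exponent p ↓ 1 against the large-deviation upper bound for kernel-smoothed block fields
under G gives P_t(entropy deficit > δ) ≤ e^(−Nκ(δ)); union over e^(o(N)) instants + modulus of
continuity. [difficulty: M] (why it might fail: needs a large-deviation upper bound for
kernel-smoothed empirical fields of the low-density hard-sphere Gibbs state at vanishing scale
N^(−γ), uniform in time (union over e^(o(N)) instants + modulus of continuity); Lean junk of η_σ on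
single-velocity or over-packed cells must stay negligible.) [Ruelle1969, Varadhan1993EntropyMethods,
KipnisLandim1999, OllaVaradhanYau1993, Spohn1991]
#8 FastMomentRelaxation (support) — (interface consumed by the Assembly) for all profiles ∃σ₀ ∀σ<σ₀
∀ flows ∀ admissible kernels ∀t>0 ∀δ>0: P(∫₀ᵗ∫ₓ |D|² + |q|² dx ds > δ) → 0 — the block traceless
kinetic stress and kinetic heat flux vanish in L²ₜ,ₓ in probability (Euler closure of the KINETIC
fluxes: momentum flux = ρ̄ū⊗ū + ρ̄θ̄𝟙 + D exactly, energy flux = Ēū + ρ̄θ̄ū + Dū + q exactly).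
[deps: CollisionalCoercivity, AprioriBounds] [difficulty: L] [ChenLevermoreLiu1994, Grad1949]
#9 CoercivityGlue (support) — CollisionalCoercivity → AprioriBounds → FastMomentRelaxation: from
(‡), κ(N+1)^(1/3) X ≤ ½‖D(0)‖² + ∫∫⟨D, T_free D⟩ + δ with X = ∫₀ᵗ∫|D|²; crude bounds ‖D(0)‖²_(L²ₓ) ≤
C(N+1)^(3γ)·(energy)², sup|D| ≤ C(N+1)^(3γ), ∫ₓ|T_free D| ≤ C(c₁)(N+1)^γ × cubic velocity moment
(kernel gradient in L¹, ρ̄ ≥ c₁ for the ū-derivative), moments from AprioriBounds(i), give X ≤ C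
N^(4γ − 1/3)/κ → 0 for γ ≤ 1/15; same for q with quartic/sextic moments via Cauchy–Schwarz in time.
[deps: CollisionalCoercivity, AprioriBounds, FastMomentRelaxation] [difficulty: M]
[ChenLevermoreLiu1994]
#9 MesoscopicLLN (support) — (statics, low-density cluster expansion; strengthens localGibbs_lln /
stmt-0767 to mesoscopic scale and L²ₓ) for all profiles ∃σ₀ ∀σ<σ₀ ∃ρ₀ continuous > 0 ∀ flows: the
local Gibbs laws are probability measures and for every admissible kernel family the block fields AT
TIME 0 converge in L²(𝕋³) in probability to (ρ₀, ρ₀u₀, ρ₀(|u₀|²/2 + 3θ₀/2)). [difficulty: M]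
[Ruelle1969, LebowitzPenrose1964, Spohn1991]
#9 HsEntropyUniformlyConvex (support) — (statics; strengthens HsEntropyConvex stmt-0817 from strict
to strong convexity and adds C²-regularity, both from HsEosLowDensity stmt-0768: f_ex analytic near
0 with f′(0) = 2π/3 ⇒ (ηZ)′ > 0 ⇒ positive-definite Hessian) ∃η₀>0: hsExcessFreeEnergy is C² on (0,
η₀) and for all σ, c₁ > 0 and E₁ there is m > 0 with η_σ − m(ρ² + |m|² + E²) convex on {c₁/2 < ρ,
ρσ³ < η₀, |m|² < 2ρE, E < E₁}. [difficulty: M] [Ruelle1969, LebowitzPenrose1964, Dafermos2005]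
#9 HsFreeEnergyConvex (support) — (statics beyond the virial radius: Ruelle convexity of the
free-energy density η ↦ η log η + η·hsExcessFreeEnergy(η) on (0, 1.1) ⊂ (0, √2), transported to
conserved variables by the perspective lemma; non-strict, phase transition allowed) for every σ > 0,
η_σ is convex on {0 < ρ, ρσ³ < 11/10, |m|² < 2ρE}. [difficulty: M] [Ruelle1969, Dafermos2005]
#9 NoImplosion (support) — (SHARED LOOPHOLE of the conjunct, isolated: the dilute chamber) for all
profiles ∃σ₀, R ∀σ<σ₀: every classical hs-Euler solution on [0,T) whose initial fields are the
local-Gibbs limits (hypothesis TendstoHydroFieldsAt at t = 0 under probability laws) has density ≤ R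
on [0,T) — uniformly in σ < σ₀ and in the classical existence time T; true for shock-type first
singularities (bounded density at gradient blow-up, uniform as σ → 0), in doubt for focusing
profiles (smooth self-similar implosion, MerleEtAl2022, is known for γ-laws only; p → ∞ at close
packing may arrest it); its refutation is a Statement-level finding, not a defeat of the mechanism.
[difficulty: open-problem] [MerleEtAl2022, Sideris1985, Majda1984]

TWO-LAYER PLAN. Foreseen glued splits (k ≤ 3, depth 1), filed only after a crux moves:
CollisionalCoercivity ⇐ AngularDoeblinMinorisation → PartnerDiversity → CollisionalCoercivity (card
K1(a),(b); the concentration of the collision martingale rides with --supports); AprioriBounds ⇐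
OneParticleExpMoment → NoEmptyNoJammedCell → AprioriBounds; RelEntropyStability ⇐
RelEntropyIdentityTorus (Dafermos (5.2.14) with defect forcing) → GronwallWithHotCells →
RelEntropyStability; SecondLawInProbability ⇐ BlockFieldLDUpperBound (statics under the global Gibbs
law) → LiouvilleHoelderTransfer → SecondLawInProbability.

KILL CRITERIA. A refutation of CollisionalCoercivity (a schedule/angular law of positive probability
along which Σ⟨D⁻, ΔD⟩ > −κν∫|D|² for every κ, or κ_N → 0) closes the route
`refuted:CollisionalCoercivity` unless FastMomentRelaxation is proved by other means first (then
restate crux 2 := FastMomentRelaxation and re-file the mechanism as a separate route). A refutation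
of CollisionalTransferLocality forces a pivot to a two-body contact-statistics crux shared with card
limit-collision-measure-chaos. A refutation of AprioriBounds(i) (fat velocity tails with positive
probability) kills every local-energy-balance line incl. this one — pivot to the Brezina–Feireisl
bookkeeping (global energy + LOCAL entropy inequality, i.e. DissipativeWeakStrong's 0824). A
refutation of NoImplosion (hs-Euler implosion from local-Gibbs-compatible profiles reaching ρσ³ ≳ η₀
at every small σ) leaves the mechanism intact but shows the conjunct's ∀-profiles closure outruns
the dilute chamber: escalate to the operator (Statement audit) and restate the Assembly on the
chamber. FluxClosure (stmt-0823) + EntropyAdmissibility (0824) proved elsewhere moot K1/K2.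

NOT DECOMPOSED YET. The split of K1 into angular minorisation / partner diversity / martingale
concentration; the split of K2 into contact-rate locality and isotropy of contact statistics; the
constants κ(σ, c₁, θ_min) and c₁(t); the kernel-existence lemma (smooth bumps on 𝕋³ at scale h, via
reprSym) and the measurability / càdlàg bookkeeping of block fields along the flow (helper lemmas,
--supports Assembly); a shared definition of the block fields / Irving–Kirkwood residuals that would
shorten K1–K2 (definition request deferred until a grounder asks); EOS convexity beyond the virial
radius is filed (HsFreeEnergyConvex) but not split; the velocity-tail mechanism (cards
apriori-tails-and-rattlers, fast-particle-energy-cascade) behind AprioriBounds(i).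

CHEAPEST FALSIFIER. Desk check of the sign structure behind (‡): for Maxwell molecules the
collisional production of the pressure deviator is exactly −νP° for every distribution
(IkenberryTruesdell1956), so (‡) holds cell-wise in conditional mean; for HARD SPHERES compute ⟨P°,
𝒫_coll(P°)⟩ and ⟨q, 𝒫_coll(q)⟩ for two-stream (bimodal) and Grad-14 distributions at fixed (ρ, E) —
one admissible velocity distribution with non-negative production pairing kills the uniform-κ form
of K1 (forces the ν_coll-weighted form) before any MD; kit/MD (card refutation (i): regress
window-averaged collisional production of P°, q on P°, q at φ = 0.05–0.2) is the next cheapest. For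
the loophole: a literature lookup whether smooth self-similar implosion survives an EOS with p → ∞
at finite density (MerleEtAl2022 treat p = ρ^γ only).

NUMBERS. ν_N = (N+1)^(1/3) collisions per particle per unit macroscopic time at fixed (N+1)ε³ = σ³
(κ absorbs πσ²ρ̄⟨|g|⟩); mesoscopic exponent 0 < γ ≤ 1/15 (crude transport bound N^(4γ) must be
o(N^(1/3)); jump noise N^(3γ−2/3), martingale fluctuation N^(9γ−2/3)); block reduced-density cap
ρ̄σ³ ≤ 1 (freezing ≈ 0.94, melting ≈ 1.04, close packing √2 ≈ 1.414 where hsFreeVolume vanishes and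
hsExcessFreeEnergy turns junk); convexity used up to ρσ³ = 1.1; Z(η) = 1 + (2π/3)η + O(η²)
(LebowitzPenrose1964); Maxwell-molecule deviator relaxation rate = ν exactly, heat-flux rate =
(2/3)ν (IkenberryTruesdell1956); items at open: 12 (5 cruxes, 6 support, 1 assembly).

DEFINITION REQUESTS. None filed now: block fields, the free-transport derivative (deriv along
Literature.Analysis.FluidPDE.freeFlight) and the Irving–Kirkwood collisional residuals are inlined
with `let` over existing declarations (empiricalDensityField/MomentumField/EnergyField,
empiricalMeasure, HardSphereFlow.flow, Torus.gradient/divergence/timeDeriv/partialDeriv, hsPressure,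
hsExcessFreeEnergy); a shared `Summits/AtomisticToContinuum/HydrodynamicLimit/Theorems` definition
of mesoscopic block fields would shorten K1/K2/K4 and is the natural first request once a grounder
stamps them.

Novelty: Searches (2026-08-15): `lit search --source crossref "Tzavaras relative entropy hyperbolic
relaxation"` (8: Tzavaras2005, LattanzioTzavaras2013, doi:10.4310/cms.2014.v12.n6.a2
Miroshnikov–Trivisa, Christoforou–Tzavaras 2017/2018); `… crossref "hydrodynamic limit particle
system compressible Euler relaxation relative entropy"` (8, none deriving Euler from particles by
relaxation structure); `… crossref "kinetic equation to multidimensional isentropic gas dynamics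
before shocks relative entropy"` (BerthelinVasseur2005, Berthelin–Bouchut 2002); `… crossref "moment
closure realizability Levermore kinetic"` (Levermore1996, doi:10.1063/1.869849); `… crossref "From
Newton's second law to Euler's equations of perfect fluids"` (HankwanIacobelli2021: mean-field,
monokinetic, modulated energy); `… crossref "hydrodynamic limit kinetic Cucker-Smale flocking
relative entropy"` (KarperMelletTrivisa2014); `… crossref "Moment methods particle systems hard
spheres pressure tensor relaxation kinetic"` (Chou2001: Enskog collisional source of the second
moment; doi:10.1063/1.4769503 R13 for hard spheres); `lit search --source zbmath "hyperbolic
conservation laws stiff relaxation terms entropy"` (ChenLevermoreLiu1994 + relaxation numerics);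
`lit frontier AtomisticToContinuum --since 2020` (30 rows, none on relaxation structure of N-body
moments); `lit bridges AtomisticToContinuum --cross any` (30; doi:10.1090/bull/1650 survey); `ledger
negatives --problem AtomisticToContinuum` (0); `lit vsearch "c  [refs: 10.4310/cms.2014.v12.n6.a2, 10.1063/1.869849, 10.1063/1.4769503, 10.1090/bull/1650, doi:10.4310/cms.2014.v12.n6.a2, doi:10.1063/1.869849, doi:10.1063/1.4769503, doi:10.1090/bull/1650, book:woods1993-introduction-kinetic-theory-gases-magnetoplasmas, book:saint-raymond2009-hydrodynamic-limits-boltzmann-equation, Tzavaras2005, LattanzioTzavaras2013, BerthelinVasseur2005, Levermore1996, HankwanIacobel]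

Barriers (technique_class: stiff-relaxation relative-energy relative-entropy): - technique_class: stiff-relaxation relative-energy relative-entropy
- Literature.Barriers.AtomisticToContinuum.ShockFormationBarrier: respected, not evaded — the
comparison state is the classical solution on [0,T) (RelEntropyStability needs a Lipschitz U_cl);
nothing is claimed past T, which is exactly the conjunct's scope.
- Literature.Barriers.AtomisticToContinuum.WildSolutionsBarrier: not met — no tightness /
measure-valued identification; uniqueness is used only against the classical solution through
relative entropy, never convex integration.
- Literature.Barriers.AtomisticToContinuum.HighMomentumCutoffBarrier: applies (true kinetic energy,
cubic energy flux) and is NOT evaded: it is isolated in AprioriBounds(i) as an order-ONE,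
time-averaged, in-probability exponential moment (far weaker than OVY's order-N exponential moments,
still a genuine dynamical input), and RelEntropyStability is engineered (e^(−λM) hot-cell
functional) to need exactly that; the bet is that one-particle tails are provable where N-particle
ones are not.
- Literature.Barriers.AtomisticToContinuum.HighMomentumCutoffBarrierNarrow: evaded by the
bookkeeping, not defeated — no entropy-inequality / Gibbs-large-deviation control of the CUBIC
energy current is attempted (its exponential moments under Maxwellian references are infinite,
`setLIntegral_exp_cubic_eq_top`, which is the narrow barrier's kernel); the cubic flux is absorbed
on the PDE side by the hot-cell functional of RelEntropyStability, which

History (route lifecycle, newest last):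
- 2026-08-15T13:47:06Z · CLOSED retired — not-a-thesis: assembly does not conclude the sub-problem Statement (operator:999:1257524)

sub-problem: HydrodynamicLimit · status: closed(retired) · opened planner-plancard-AtomisticToContinuum-Hydrody-8730473f-0 2026-08-15T12:05:35Z · rev 0 · ledger route-AtomisticToContinuum-StiffRelaxation
GENERATED by the gate from the ledger (D-0016/17). Provers cite these decls: `theorem foo : Summit.AtomisticToContinuum.HydrodynamicLimit.Theses.StiffRelaxation.<Decl> := …` in Summits/AtomisticToContinuum/HydrodynamicLimit/Theorems/<Name>.lean.
-/

namespace Summit.AtomisticToContinuum.HydrodynamicLimit.Theses.StiffRelaxation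

open scoped BigOperators Topology Manifold Classical MeasureTheory ProbabilityTheory Matrix InnerProductSpace ComplexConjugate ContinuousMap
open Filter Set Function TopologicalSpace MeasureTheory

attribute [summit_statement] _root_.HydrodynamicLimit

/-- item stmt-AtomisticToContinuum-7229 · crux · rank 2 · closed · moot by None · by planner
why it might fail: κ must be uniform over cold/dilute cells and adversarial pairings; angular Doeblin minorisation alone cannot contract anisotropy along an adversarial direction (partner diversity is load-bearing); the q-part couples to quartic moments; no collisional coercivity is proved for any N-body flow.
sources: ChenLevermoreLiu1994, IkenberryTruesdell1956, Chou2001, Grad1949, ChapmanCowling1970, Levermore1996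
[crux] (card K1, typed as the stiff dissipation inequality (‡)) for all continuous profiles ∃σ₀
∀σ<σ₀ ∀ flows ∀γ∈(0,1/15] ∀ admissible kernel families φ_N (smooth, ≥ 0, ∫φ_N = 1, supported in the
ball of radius (N+1)^(−γ), φ_N ≤ C(N+1)^(3γ), |∇φ_N| ≤ C(N+1)^(4γ)) ∀t>0 ∃κ>0 ∀δ>0: with probability
→ 1 under localGibbsLaw, BOTH κ(N+1)^(1/3)∫₀ᵗ∫ₓ|D|² + ½∫ₓ|D(t)|² ≤ ½∫ₓ|D(0)|² + ∫₀ᵗ∫ₓ⟨D, T_free D⟩ +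
δ AND the same inequality for q, where D(x) = traceless part of ∫φ_N(y−x)(v−ū(x))⊗(v−ū(x)) dμ_N
(block central kinetic stress), q(x) = ∫φ_N(y−x)|v−ū|²(v−ū)/2 dμ_N (block kinetic heat flux), ū =
m̄/ρ̄, T_free O(z) = d/dτ O(freeFlight τ z) at τ = 0; intended proof = angular Doeblin minorisation
of the collision normal + partner diversity on the |g|-weighted collision multigraph + concentration
of the collision martingale (jump noise N^(3γ−2/3), fluctuation N^(9γ−2/3) → 0 for γ ≤ 1/15).
[difficulty: XL] -/
@[route_item "route-AtomisticToContinuum-StiffRelaxation"]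
def CollisionalCoercivity : Prop :=
  ∀ (a₀ θ₀ : (UnitAddTorus (Fin 3)) → ℝ) (u₀ : (UnitAddTorus (Fin 3)) → (EuclideanSpace ℝ (Fin 3))), Continuous a₀ → Continuous θ₀ → Continuous u₀ → (∀ x, 0 < a₀ x) → (∀ x, 0 < θ₀ x) → ∃ σ₀ : ℝ, 0 < σ₀ ∧ ∀ σ : ℝ, 0 < σ → σ < σ₀ → ∀ Φ : (N : ℕ) → Literature.Analysis.FluidPDE.HardSphereFlow (Literature.Analysis.FluidPDE.Torus.geometry (Fin 3)) (Literature.MathematicalPhysics.KineticTheory.hsDiameter σ N) (N + 1), ∀ (γ C : ℝ) (φ : ℕ → (UnitAddTorus (Fin 3)) → ℝ), 0 < γ → γ ≤ 1 / 15 → ((∀ N, Literature.Analysis.FunctionSpaces.Torus.IsSmooth (φ N)) ∧ (∀ N y, 0 ≤ φ N y) ∧ (∀ N, ∫ y, φ N y = 1) ∧ (∀ (N : ℕ) y, ((N : ℝ) + 1) ^ (-γ) ≤ Literature.Analysis.FluidPDE.Torus.euclidDist y 0 → φ N y = 0) ∧ (∀ (N : ℕ) y, φ N y ≤ C * ((N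 : ℝ) + 1) ^ (3 * γ)) ∧ (∀ (N : ℕ) y, ‖Literature.Analysis.FunctionSpaces.Torus.gradient (φ N) y‖ ≤ C * ((N : ℝ) + 1) ^ (4 * γ))) → let ρb := fun (N : ℕ) (z : Literature.Analysis.FluidPDE.Config (N + 1) (Fin 3) (UnitAddTorus (Fin 3))) (x : (UnitAddTorus (Fin 3))) => Literature.MathematicalPhysics.KineticTheory.empiricalDensityField z (fun y => φ N (y - x)); let mb := fun (N : ℕ) (z : Literature.Analysis.FluidPDE.Config (N + 1) (Fin 3) (UnitAddTorus (Fin 3))) (x : (UnitAddTorus (Fin 3))) => Literature.MathematicalPhysics.KineticTheory.empiricalMomentumField z (fun y => φ N (y - x)); let ub := fun (N : ℕ) (z : Literature.Analysis.FluidPDE.Config (N + 1) (Fin 3) (UnitAddTorus (Fin 3))) (x : (UnitAddTorus (Fin 3))) => (ρb N z x)⁻¹ • mb N z x; let D := fun (N : ℕ) (z : Literature.Analysis.FluidPDE.Config (N + 1) (Fin 3) (UnitAddTorus (Fin 3))) (x : (UnitAddTorus (Fin 3))) (j k : Fin 3) => (∫ y, φ N (y.1 - x) * ((y.2 j - ub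 N z x j) * (y.2 k - ub N z x k)) ∂(Literature.Analysis.FluidPDE.empiricalMeasure z)) - (if j = k then (∑ l : Fin 3, ∫ y, φ N (y.1 - x) * (y.2 l - ub N z x l) ^ 2 ∂(Literature.Analysis.FluidPDE.empiricalMeasure z)) / 3 else 0); let q := fun (N : ℕ) (z : Literature.Analysis.FluidPDE.Config (N + 1) (Fin 3) (UnitAddTorus (Fin 3))) (x : (UnitAddTorus (Fin 3))) => ∫ y, (φ N (y.1 - x) * ‖y.2 - ub N z x‖ ^ 2 / 2) • (y.2 - ub N z x) ∂(Literature.Analysis.FluidPDE.empiricalMeasure z); let TD := fun (N : ℕ) (z : Literature.Analysis.FluidPDE.Config (N + 1) (Fin 3) (UnitAddTorus (Fin 3))) (x : (UnitAddTorus (Fin 3))) (j k : Fin 3) => deriv (fun τ : ℝ => D N (Literature.Analysis.FluidPDE.freeFlight (Literature.Analysis.FluidPDE.Torus.geometry (Fin 3)) τ z) x j k) 0; let Tq := fun (N : ℕ) (z : Literature.Analysis.FluidPDE.Config (N + 1) (Fin 3) (UnitAddTorus (Fin 3))) (x : (UnitAddTorus (Fin 3))) => deriv (fun τ : ℝ =>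 q N (Literature.Analysis.FluidPDE.freeFlight (Literature.Analysis.FluidPDE.Torus.geometry (Fin 3)) τ z) x) 0; ∀ t : ℝ, 0 < t → ∃ κ : ℝ, 0 < κ ∧ ∀ δ : ℝ, 0 < δ → Tendsto (fun N : ℕ => Literature.MathematicalPhysics.KineticTheory.localGibbsLaw σ a₀ u₀ θ₀ N (Φ N) {z | ¬ ((κ * ((N : ℝ) + 1) ^ (1 / 3 : ℝ) * (∫ s in Icc 0 t, ∫ x, ∑ j, ∑ k, D N ((Φ N).flow s z) x j k ^ 2) + (∫ x, ∑ j, ∑ k, D N ((Φ N).flow t z) x j k ^ 2) / 2 ≤ (∫ x, ∑ j, ∑ k, D N ((Φ N).flow 0 z) x j k ^ 2) / 2 + (∫ s in Icc 0 t, ∫ x, ∑ j, ∑ k, D N ((Φ N).flow s z) x j k * TD N ((Φ N).flow s z) x j k) + δ) ∧ (κ * ((N : ℝ) + 1) ^ (1 / 3 : ℝ) * (∫ s in Icc 0 t, ∫ x, ‖q N ((Φ N).flow s z) x‖ ^ 2) + (∫ x, ‖q N ((Φ N).flow t z) x‖ ^ 2) / 2 ≤ (∫ x, ‖q N ((Φ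 N).flow 0 z) x‖ ^ 2) / 2 + (∫ s in Icc 0 t, ∫ x, ∑ j, q N ((Φ N).flow s z) x j * Tq N ((Φ N).flow s z) x j) + δ))}) atTop (𝓝 0)

/-- item stmt-AtomisticToContinuum-7230 · crux · rank 3 · closed · moot by None · by planner
why it might fail: contact pair statistics (rate × transfer) are two-body quantities collisions do not relax: out of equilibrium the contact value and isotropy of g₂ could lag the block fields beyond o(1); `deriv` junk in Z(η) off the analytic region bites if dense mesoscopic clusters have positive probability.
sources: Spohn1991, IrvingKirkwood1950, ChapmanCowling1970, Resibois1978, Chou2001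
[crux] (card K2) for all profiles ∃σ₀ ∀σ<σ₀ ∀ flows ∀ admissible kernels ∀t>0 ∀ smooth space–time
test fields ψ (V3-valued), χ (scalar) on [0,t] ∀δ>0: with probability → 1, for ALL τ ≤ t, |Cc(τ) −
∫₀^τ∫ₓ (div ψ + ∇χ·ū) p_c(ρ̄, θ̄)| ≤ δ, where Cc(τ) = [⟨μ, ψ·v + χ|v|²/2⟩]₀^τ − ∫₀^τ(⟨μ, ∂_sψ·v +
∂_sχ|v|²/2⟩ + T_free⟨μ, ψ·v + χ|v|²/2⟩) ds is BY DEFINITION the collisional momentum-plus-energy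
transfer tested against (ψ, χ) (the exact Irving–Kirkwood residual of the tested balance laws after
the time-derivative and free-transport terms; χ = 0 resp. ψ = 0 give the momentum resp. energy
statements), p_c(ρ, θ) = hsPressure σ ρ θ − ρθ = ρθ(Z(ρσ³) − 1) is the collisional pressure, ū =
m̄/ρ̄ and θ̄ = (2/3)(Ē/ρ̄ − |m̄|²/(2ρ̄²)); i.e. the line-averaged collisional stress is isotropic
and a local function of the block fields, the collisional energy flux is p_c ū, and there is no
collisional heat flux at leading order. [difficulty: L] -/
@[route_item "route-AtomisticToContinuum-StiffRelaxation"]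
def CollisionalTransferLocality : Prop :=
  ∀ (a₀ θ₀ : (UnitAddTorus (Fin 3)) → ℝ) (u₀ : (UnitAddTorus (Fin 3)) → (EuclideanSpace ℝ (Fin 3))), Continuous a₀ → Continuous θ₀ → Continuous u₀ → (∀ x, 0 < a₀ x) → (∀ x, 0 < θ₀ x) → ∃ σ₀ : ℝ, 0 < σ₀ ∧ ∀ σ : ℝ, 0 < σ → σ < σ₀ → ∀ Φ : (N : ℕ) → Literature.Analysis.FluidPDE.HardSphereFlow (Literature.Analysis.FluidPDE.Torus.geometry (Fin 3)) (Literature.MathematicalPhysics.KineticTheory.hsDiameter σ N) (N + 1), ∀ (γ C : ℝ) (φ : ℕ → (UnitAddTorus (Fin 3)) → ℝ), 0 < γ → γ ≤ 1 / 15 → ((∀ N, Literature.Analysis.FunctionSpaces.Torus.IsSmooth (φ N)) ∧ (∀ N y, 0 ≤ φ N y) ∧ (∀ N, ∫ y, φ N y = 1) ∧ (∀ (N : ℕ) y, ((N : ℝ) + 1) ^ (-γ) ≤ Literature.Analysis.FluidPDE.Torus.euclidDist y 0 → φ N y = 0) ∧ (∀ (N : ℕ) y, φ N y ≤ C * ((N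 : ℝ) + 1) ^ (3 * γ)) ∧ (∀ (N : ℕ) y, ‖Literature.Analysis.FunctionSpaces.Torus.gradient (φ N) y‖ ≤ C * ((N : ℝ) + 1) ^ (4 * γ))) → let ρb := fun (N : ℕ) (z : Literature.Analysis.FluidPDE.Config (N + 1) (Fin 3) (UnitAddTorus (Fin 3))) (x : (UnitAddTorus (Fin 3))) => Literature.MathematicalPhysics.KineticTheory.empiricalDensityField z (fun y => φ N (y - x)); let mb := fun (N : ℕ) (z : Literature.Analysis.FluidPDE.Config (N + 1) (Fin 3) (UnitAddTorus (Fin 3))) (x : (UnitAddTorus (Fin 3))) => Literature.MathematicalPhysics.KineticTheory.empiricalMomentumField z (fun y => φ N (y - x)); let Eb := fun (N : ℕ) (z : Literature.Analysis.FluidPDE.Config (N + 1) (Fin 3) (UnitAddTorus (Fin 3))) (x : (UnitAddTorus (Fin 3))) => Literature.MathematicalPhysics.KineticTheory.empiricalEnergyField z (fun y => φ N (y - x)); let ub := fun (N : ℕ) (z : Literature.Analysis.FluidPDE.Config (N + 1) (Fin 3) (UnitAddTorus (Fin 3))) (x : (UnitAddTorus (Fin 3))) => (ρb N z x)⁻¹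 • mb N z x; let θb := fun (N : ℕ) (z : Literature.Analysis.FluidPDE.Config (N + 1) (Fin 3) (UnitAddTorus (Fin 3))) (x : (UnitAddTorus (Fin 3))) => 2 / 3 * (Eb N z x / ρb N z x - ‖mb N z x‖ ^ 2 / (2 * ρb N z x ^ 2)); let pc := fun (r th : ℝ) => Literature.MathematicalPhysics.KineticTheory.hsPressure σ r th - r * th; ∀ t : ℝ, 0 < t → ∀ (ψ : ℝ → (UnitAddTorus (Fin 3)) → (EuclideanSpace ℝ (Fin 3))) (χ : ℝ → (UnitAddTorus (Fin 3)) → ℝ), Literature.Analysis.FunctionSpaces.Torus.IsSmoothSpaceTimeOn (Icc 0 t) ψ → Literature.Analysis.FunctionSpaces.Torus.IsSmoothSpaceTimeOn (Icc 0 t) χ → let O := fun (N : ℕ) (s : ℝ) (z : Literature.Analysis.FluidPDE.Config (N + 1) (Fin 3) (UnitAddTorus (Fin 3))) => ∫ y, ((∑ j, ψ s y.1 j * y.2 j) + χ s y.1 * (‖y.2‖ ^ 2 / 2)) ∂(Literature.Analysis.FluidPDE.empiricalMeasure z); let Cc := fun (N : ℕ) (z : Literature.Analysis.FluidPDE.Config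 (N + 1) (Fin 3) (UnitAddTorus (Fin 3))) (τ : ℝ) => O N τ ((Φ N).flow τ z) - O N 0 ((Φ N).flow 0 z) - ∫ s in Icc 0 τ, ((∫ y, ((∑ j, Literature.Analysis.FunctionSpaces.Torus.timeDeriv ψ s y.1 j * y.2 j) + Literature.Analysis.FunctionSpaces.Torus.timeDeriv χ s y.1 * (‖y.2‖ ^ 2 / 2)) ∂(Literature.Analysis.FluidPDE.empiricalMeasure ((Φ N).flow s z))) + deriv (fun r : ℝ => O N s (Literature.Analysis.FluidPDE.freeFlight (Literature.Analysis.FluidPDE.Torus.geometry (Fin 3)) r ((Φ N).flow s z))) 0); ∀ δ : ℝ, 0 < δ → Tendsto (fun N : ℕ => Literature.MathematicalPhysics.KineticTheory.localGibbsLaw σ a₀ u₀ θ₀ N (Φ N) {z | ∃ τ ∈ Icc 0 t, δ < |Cc N z τ - ∫ s in Icc 0 τ, ∫ x, (Literature.Analysis.FunctionSpaces.Torus.divergence (ψ s) x + ∑ j, Literature.Analysis.FunctionSpaces.Torus.gradient (χ s) x j * ub N ((Φ N).flow s z) x j) * pc (ρb N ((Φ N).flow s z) x) (θb N ((Φ N).flow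 s z) x)|}) atTop (𝓝 0)

/-- item stmt-AtomisticToContinuum-7231 · crux · rank 4 · closed · moot by None · by planner
why it might fail: no dynamical velocity-tail or anti-clustering estimate is known for hard spheres at fixed density (OVY had to modify the kinetic energy — HighMomentumCutoff barrier); particles of speed ≫ √log N, or one empty/jammed cell of side N^(−γ) before time t with non-vanishing probability, break it.
sources: OllaVaradhanYau1993, Alexander1975, GST2013, Spohn1991
[crux] (card K4 strengthened to what the glue provably needs) for all profiles ∃σ₀ ∀σ<σ₀ ∀ flows
∀t>0: (i) ∃λ>0, C: with probability → 1, ∫₀ᵗ (N+1)⁻¹Σᵢ exp(λ|vᵢ(s)|²) ds ≤ C (time-averaged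
ONE-particle exponential velocity moment; order one, not order N); (ii) for every admissible kernel
family ∃c₁>0: with probability → 1, for all s ≤ t and all x, c₁ ≤ ρ̄(s,x) and ρ̄(s,x)σ³ ≤ 1 (no
empty and no jammed mesoscopic cell; 1 < √2 = close packing keeps hsExcessFreeEnergy junk-free).
[difficulty: L] -/
@[route_item "route-AtomisticToContinuum-StiffRelaxation"]
def AprioriBounds : Prop :=
  ∀ (a₀ θ₀ : (UnitAddTorus (Fin 3)) → ℝ) (u₀ : (UnitAddTorus (Fin 3)) → (EuclideanSpace ℝ (Fin 3))), Continuous a₀ → Continuous θ₀ → Continuous u₀ → (∀ x, 0 < a₀ x) → (∀ x, 0 < θ₀ x) → ∃ σ₀ : ℝ, 0 < σ₀ ∧ ∀ σ : ℝ, 0 < σ → σ < σ₀ → ∀ Φ : (N : ℕ) → Literature.Analysis.FluidPDE.HardSphereFlow (Literature.Analysis.FluidPDE.Torus.geometry (Fin 3)) (Literature.MathematicalPhysics.KineticTheory.hsDiameter σ N) (N + 1), ∀ t : ℝ, 0 < t → (∃ lam Cexp : ℝ, 0 < lam ∧ Tendsto (fun N : ℕ => Literature.MathematicalPhysics.KineticTheory.localGibbsLaw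 σ a₀ u₀ θ₀ N (Φ N) {z | Cexp < ∫ s in Icc 0 t, ∫ y, Real.exp (lam * ‖y.2‖ ^ 2) ∂(Literature.Analysis.FluidPDE.empiricalMeasure ((Φ N).flow s z))}) atTop (𝓝 0)) ∧ (∀ (γ C : ℝ) (φ : ℕ → (UnitAddTorus (Fin 3)) → ℝ), 0 < γ → γ ≤ 1 / 15 → ((∀ N, Literature.Analysis.FunctionSpaces.Torus.IsSmooth (φ N)) ∧ (∀ N y, 0 ≤ φ N y) ∧ (∀ N, ∫ y, φ N y = 1) ∧ (∀ (N : ℕ) y, ((N : ℝ) + 1) ^ (-γ) ≤ Literature.Analysis.FluidPDE.Torus.euclidDist y 0 → φ N y = 0) ∧ (∀ (N : ℕ) y, φ N y ≤ C * ((N : ℝ) + 1) ^ (3 * γ)) ∧ (∀ (N : ℕ) y, ‖Literature.Analysis.FunctionSpaces.Torus.gradient (φ N) y‖ ≤ C * ((N : ℝ) + 1) ^ (4 * γ))) → ∃ c₁ : ℝ, 0 < c₁ ∧ Tendsto (fun N : ℕ => Literature.MathematicalPhysics.KineticTheory.localGibbsLaw σ a₀ u₀ θ₀ N (Φ N) {z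 | ∃ s ∈ Icc 0 t, ∃ x : (UnitAddTorus (Fin 3)), Literature.MathematicalPhysics.KineticTheory.empiricalDensityField ((Φ N).flow s z) (fun y => φ N (y - x)) < c₁ ∨ 1 < Literature.MathematicalPhysics.KineticTheory.empiricalDensityField ((Φ N).flow s z) (fun y => φ N (y - x)) * σ ^ 3}) atTop (𝓝 0))

/-- item stmt-AtomisticToContinuum-7232 · crux · rank 5 · closed · moot by None · by planner
why it might fail: the energy flux is cubic in velocity while relative entropy is quadratic: the Gronwall constant grows like e^(C√M·t) on {E ≤ Mρ} and must be beaten by the e^(−λM) hot-cell allowance, and dense cells rely on mere convexity up to ρσ³ = 1.1 — a gap in either trade-off falsifies the stated δ-uniformity.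
sources: Dafermos1979, Dafermos2005, Tzavaras2005, BerthelinVasseur2005, BerthelinTzavarasVasseur2009, BrezinaFeireisl2018
[crux] (card K3, the PDE half, deterministic) for σ, η₀, c₁, λ, C > 0 with hsExcessFreeEnergy C² on
(0, η₀), η_σ = −ρs strongly convex (modulus m(E₁) > 0) on each chamber {c₁/2 < ρ, ρσ³ < η₀, |m|² <
2ρE, E < E₁} and convex on {0 < ρ, ρσ³ < 11/10, |m|² < 2ρE}, every classical hs-Euler solution U_cl
= (ρ, ρu, E) on [0,T) with c₁ ≤ ρ and 2ρσ³ < η₀, every t₁ < T and ε > 0 admit δ > 0 such that every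
bounded jointly measurable field U : ℝ → 𝕋³ → ℝ×V3×ℝ, continuous in x, with values in {c₁ ≤ ρ, ρσ³ ≤
1, |m|² < 2ρE} on [0,t₁], initial relative entropy ∫h(U(0)|U_cl(0)) ≤ δ, approximate global entropy
inequality ∫η_σ(U(τ)) ≤ ∫η_σ(U(0)) + δ (τ ≤ t₁), hot-cell functional ∫₀^t₁∫ 1(E >
Mρ)(E^(3/2)ρ^(−1/2) + E + ρ) ≤ C e^(−λM) for all M ≥ 1, and weak residual |[∫Λ·U]₀^τ − ∫₀^τ∫(∂_sΛ·U
+ Σ_j ∂_jΛ·F_j(U))| ≤ δ (τ ≤ t₁) against Λ = Dη_σ(U_cl) with the hs-Euler fluxes F_j, satisfies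
∫ₓ(|ρ̄−ρ| + |m̄−ρu| + |Ē−E|)(τ) ≤ ε for all τ ≤ t₁ (Dafermos 5.2.14 on 𝕋³ with the defect as
forcing, Gronwall on {E ≤ Mρ} with constant e^(C√M t) beaten by e^(−λM), linear growth of h on
dense/hot cells). [difficulty: L] -/
@[route_item "route-AtomisticToContinuum-StiffRelaxation"]
def RelEntropyStability : Prop :=
  ∀ (σ η₀ c₁ lam Cexp : ℝ), 0 < σ → 0 < η₀ → 0 < c₁ → 0 < lam → let ησ := fun U : ℝ × (EuclideanSpace ℝ (Fin 3)) × ℝ => -(U.1 * (3 / 2 * Real.log (2 / 3 * (U.2.2 / U.1 - ‖U.2.1‖ ^ 2 / (2 * U.1 ^ 2))) - Real.log U.1 - Literature.MathematicalPhysics.KineticTheory.hsExcessFreeEnergy (U.1 * σ ^ 3))); ContDiffOn ℝ 2 Literature.MathematicalPhysics.KineticTheory.hsExcessFreeEnergy (Set.Ioo 0 η₀) → (∀ E₁ : ℝ, ∃ m : ℝ, 0 < m ∧ ConvexOn ℝ {U : ℝ × (EuclideanSpace ℝ (Fin 3)) × ℝ | c₁ / 2 < U.1 ∧ U.1 * σ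 ^ 3 < η₀ ∧ ‖U.2.1‖ ^ 2 < 2 * U.1 * U.2.2 ∧ U.2.2 < E₁} (fun U : ℝ × (EuclideanSpace ℝ (Fin 3)) × ℝ => ησ U - m * (U.1 ^ 2 + ‖U.2.1‖ ^ 2 + U.2.2 ^ 2))) → ConvexOn ℝ {U : ℝ × (EuclideanSpace ℝ (Fin 3)) × ℝ | 0 < U.1 ∧ U.1 * σ ^ 3 < 11 / 10 ∧ ‖U.2.1‖ ^ 2 < 2 * U.1 * U.2.2} ησ → ∀ (T : ℝ) (ρ θ : ℝ → (UnitAddTorus (Fin 3)) → ℝ) (u : ℝ → (UnitAddTorus (Fin 3)) → (EuclideanSpace ℝ (Fin 3))), Literature.MathematicalPhysics.KineticTheory.IsHardSphereEulerSolution σ T ρ u θ → (∀ t ∈ Ico 0 T, ∀ x, c₁ ≤ ρ t x ∧ 2 * ρ t x * σ ^ 3 < η₀) → let Ucl := fun (s : ℝ) (x : (UnitAddTorus (Fin 3))) => ((ρ s x, ρ s x • u s x, Literature.MathematicalPhysics.KineticTheory.totalEnergyDensity (ρ s x) (u s x) (θ s x)) : ℝ × (EuclideanSpace ℝ (Fin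 3)) × ℝ); let Λ := fun (s : ℝ) (x : (UnitAddTorus (Fin 3))) => fderiv ℝ ησ (Ucl s x); let Fl := fun (j : Fin 3) (U : ℝ × (EuclideanSpace ℝ (Fin 3)) × ℝ) => ((U.2.1 j, (U.2.1 j / U.1) • U.2.1 + Literature.MathematicalPhysics.KineticTheory.hsPressure σ U.1 (2 / 3 * (U.2.2 / U.1 - ‖U.2.1‖ ^ 2 / (2 * U.1 ^ 2))) • EuclideanSpace.single j (1 : ℝ), (U.2.2 + Literature.MathematicalPhysics.KineticTheory.hsPressure σ U.1 (2 / 3 * (U.2.2 / U.1 - ‖U.2.1‖ ^ 2 / (2 * U.1 ^ 2)))) * U.2.1 j / U.1) : ℝ × (EuclideanSpace ℝ (Fin 3)) × ℝ); ∀ t₁ ∈ Ico 0 T, ∀ ε : ℝ, 0 < ε → ∃ δ : ℝ, 0 < δ ∧ ∀ U : ℝ → (UnitAddTorus (Fin 3)) → ℝ × (EuclideanSpace ℝ (Fin 3)) × ℝ, Measurable (Function.uncurry U) → (∃ B : ℝ, ∀ s x, ‖U s x‖ ≤ B) → (∀ s, Continuous (U s)) → (∀ s ∈ Icc 0 t₁,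 ∀ x, c₁ ≤ (U s x).1 ∧ (U s x).1 * σ ^ 3 ≤ 1 ∧ ‖(U s x).2.1‖ ^ 2 < 2 * (U s x).1 * (U s x).2.2) → (∫ x, (ησ (U 0 x) - ησ (Ucl 0 x) - Λ 0 x (U 0 x - Ucl 0 x))) ≤ δ → (∀ τ ∈ Icc 0 t₁, (∫ x, ησ (U τ x)) ≤ (∫ x, ησ (U 0 x)) + δ) → (∀ M : ℝ, 1 ≤ M → (∫ s in Icc 0 t₁, ∫ x, (if M * (U s x).1 < (U s x).2.2 then (U s x).2.2 ^ (3 / 2 : ℝ) / Real.sqrt ((U s x).1) + (U s x).2.2 + (U s x).1 else 0)) ≤ Cexp * Real.exp (-(lam * M))) → (∀ τ ∈ Icc 0 t₁, |(∫ x, Λ τ x (U τ x)) - (∫ x, Λ 0 x (U 0 x)) - ∫ s in Icc 0 τ, ∫ x, (Literature.Analysis.FunctionSpaces.Torus.timeDeriv Λ s x (U s x) + ∑ j, Literature.Analysis.FunctionSpaces.Torus.partialDeriv j (Λ s) x (Fl j (U s x)))| ≤ δ) → ∀ τ ∈ Icc 0 t₁, (∫ x, (|(U τ x).1 - ρ τ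 x| + ‖(U τ x).2.1 - ρ τ x • u τ x‖ + |(U τ x).2.2 - Literature.MathematicalPhysics.KineticTheory.totalEnergyDensity (ρ τ x) (u τ x) (θ τ x)|)) ≤ ε

/-- item stmt-AtomisticToContinuum-7233 · crux · rank 6 · closed · moot by None · by planner
why it might fail: needs a large-deviation upper bound for kernel-smoothed empirical fields of the low-density hard-sphere Gibbs state at vanishing scale N^(−γ), uniform in time (union over e^(o(N)) instants + modulus of continuity); Lean junk of η_σ on single-velocity or over-packed cells must stay negligible.
sources: Ruelle1969, Varadhan1993EntropyMethods, KipnisLandim1999, OllaVaradhanYau1993, Spohn1991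
[crux] (card "free input (ii)" of invariant-gibbs-entropy-bookkeeping, made a crux) for all profiles
∃σ₀ ∀σ<σ₀ ∀ flows ∀ admissible kernels ∀t>0 ∀δ>0: with probability → 1 under localGibbsLaw, for ALL
τ ≤ t, ∫ₓ η_σ(Ū_N(τ, x)) dx ≤ ∫ₓ η_σ(Ū_N(0, x)) dx + δ, with η_σ(ρ, m, E) = −ρ(3/2 log θ − log ρ −
hsExcessFreeEnergy(ρσ³)), θ = (2/3)(E/ρ − |m|²/(2ρ²)) (the entropy of stmt-0817); intended proof:
relative entropy w.r.t. the INVARIANT global Gibbs law G is conserved, dP_t/dG = (dP₀/dG)∘Φ_(−t) is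
an exponential of a linear empirical functional of conserved type, Hölder with exponent p ↓ 1
against the large-deviation upper bound for kernel-smoothed block fields under G gives P_t(entropy
deficit > δ) ≤ e^(−Nκ(δ)); union over e^(o(N)) instants + modulus of continuity. [difficulty: M] -/
@[route_item "route-AtomisticToContinuum-StiffRelaxation"]
def SecondLawInProbability : Prop :=
  ∀ (a₀ θ₀ : (UnitAddTorus (Fin 3)) → ℝ) (u₀ : (UnitAddTorus (Fin 3)) → (EuclideanSpace ℝ (Fin 3))), Continuous a₀ → Continuous θ₀ → Continuous u₀ → (∀ x, 0 < a₀ x) → (∀ x, 0 < θ₀ x) → ∃ σ₀ : ℝ, 0 < σ₀ ∧ ∀ σ : ℝ, 0 < σ → σ < σ₀ → ∀ Φ : (N : ℕ) → Literature.Analysis.FluidPDE.HardSphereFlow (Literature.Analysis.FluidPDE.Torus.geometry (Fin 3)) (Literature.MathematicalPhysics.KineticTheory.hsDiameter σ N) (N + 1), ∀ (γ C : ℝ) (φ : ℕ → (UnitAddTorus (Fin 3)) → ℝ), 0 < γ → γ ≤ 1 / 15 → ((∀ N, Literature.Analysis.FunctionSpaces.Torus.IsSmooth (φ N)) ∧ (∀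 N y, 0 ≤ φ N y) ∧ (∀ N, ∫ y, φ N y = 1) ∧ (∀ (N : ℕ) y, ((N : ℝ) + 1) ^ (-γ) ≤ Literature.Analysis.FluidPDE.Torus.euclidDist y 0 → φ N y = 0) ∧ (∀ (N : ℕ) y, φ N y ≤ C * ((N : ℝ) + 1) ^ (3 * γ)) ∧ (∀ (N : ℕ) y, ‖Literature.Analysis.FunctionSpaces.Torus.gradient (φ N) y‖ ≤ C * ((N : ℝ) + 1) ^ (4 * γ))) → let ρb := fun (N : ℕ) (z : Literature.Analysis.FluidPDE.Config (N + 1) (Fin 3) (UnitAddTorus (Fin 3))) (x : (UnitAddTorus (Fin 3))) => Literature.MathematicalPhysics.KineticTheory.empiricalDensityField z (fun y => φ N (y - x)); let mb := fun (N : ℕ) (z : Literature.Analysis.FluidPDE.Config (N + 1) (Fin 3) (UnitAddTorus (Fin 3))) (x : (UnitAddTorus (Fin 3))) => Literature.MathematicalPhysics.KineticTheory.empiricalMomentumField z (fun y => φ N (y - x)); let Eb := fun (N : ℕ) (z : Literature.Analysis.FluidPDE.Config (N + 1) (Fin 3) (UnitAddTorus (Fin 3))) (x : (UnitAddTorus (Fin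 3))) => Literature.MathematicalPhysics.KineticTheory.empiricalEnergyField z (fun y => φ N (y - x)); let ησ := fun U : ℝ × (EuclideanSpace ℝ (Fin 3)) × ℝ => -(U.1 * (3 / 2 * Real.log (2 / 3 * (U.2.2 / U.1 - ‖U.2.1‖ ^ 2 / (2 * U.1 ^ 2))) - Real.log U.1 - Literature.MathematicalPhysics.KineticTheory.hsExcessFreeEnergy (U.1 * σ ^ 3))); ∀ t : ℝ, 0 < t → ∀ δ : ℝ, 0 < δ → Tendsto (fun N : ℕ => Literature.MathematicalPhysics.KineticTheory.localGibbsLaw σ a₀ u₀ θ₀ N (Φ N) {z | ∃ τ ∈ Icc 0 t, (∫ x, ησ (ρb N ((Φ N).flow 0 z) x, mb N ((Φ N).flow 0 z) x, Eb N ((Φ N).flow 0 z) x)) + δ < ∫ x, ησ (ρb N ((Φ N).flow τ z) x, mb N ((Φ N).flow τ z) x, Eb N ((Φ N).flow τ z) x)}) atTop (𝓝 0)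

/-- item stmt-AtomisticToContinuum-7234 · support · rank 8 · closed · moot by None · by planner
sources: ChenLevermoreLiu1994, Grad1949
[support] (interface consumed by the Assembly) for all profiles ∃σ₀ ∀σ<σ₀ ∀ flows ∀ admissible
kernels ∀t>0 ∀δ>0: P(∫₀ᵗ∫ₓ |D|² + |q|² dx ds > δ) → 0 — the block traceless kinetic stress and
kinetic heat flux vanish in L²ₜ,ₓ in probability (Euler closure of the KINETIC fluxes: momentum flux
= ρ̄ū⊗ū + ρ̄θ̄𝟙 + D exactly, energy flux = Ēū + ρ̄θ̄ū + Dū + q exactly). [deps: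
CollisionalCoercivity, AprioriBounds] [difficulty: L] -/
@[route_item "route-AtomisticToContinuum-StiffRelaxation"]
def FastMomentRelaxation : Prop :=
  ∀ (a₀ θ₀ : (UnitAddTorus (Fin 3)) → ℝ) (u₀ : (UnitAddTorus (Fin 3)) → (EuclideanSpace ℝ (Fin 3))), Continuous a₀ → Continuous θ₀ → Continuous u₀ → (∀ x, 0 < a₀ x) → (∀ x, 0 < θ₀ x) → ∃ σ₀ : ℝ, 0 < σ₀ ∧ ∀ σ : ℝ, 0 < σ → σ < σ₀ → ∀ Φ : (N : ℕ) → Literature.Analysis.FluidPDE.HardSphereFlow (Literature.Analysis.FluidPDE.Torus.geometry (Fin 3)) (Literature.MathematicalPhysics.KineticTheory.hsDiameter σ N) (N + 1), ∀ (γ C : ℝ) (φ : ℕ → (UnitAddTorus (Fin 3)) → ℝ), 0 < γ → γ ≤ 1 / 15 → ((∀ N, Literature.Analysis.FunctionSpaces.Torus.IsSmooth (φ N)) ∧ (∀ N y, 0 ≤ φ N y) ∧ (∀ N, ∫ y, φ N y = 1) ∧ (∀ (N : ℕ) y, ((N : ℝ) + 1) ^ (-γ) ≤ Literature.Analysis.FluidPDE.Torus.euclidDist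 y 0 → φ N y = 0) ∧ (∀ (N : ℕ) y, φ N y ≤ C * ((N : ℝ) + 1) ^ (3 * γ)) ∧ (∀ (N : ℕ) y, ‖Literature.Analysis.FunctionSpaces.Torus.gradient (φ N) y‖ ≤ C * ((N : ℝ) + 1) ^ (4 * γ))) → let ρb := fun (N : ℕ) (z : Literature.Analysis.FluidPDE.Config (N + 1) (Fin 3) (UnitAddTorus (Fin 3))) (x : (UnitAddTorus (Fin 3))) => Literature.MathematicalPhysics.KineticTheory.empiricalDensityField z (fun y => φ N (y - x)); let mb := fun (N : ℕ) (z : Literature.Analysis.FluidPDE.Config (N + 1) (Fin 3) (UnitAddTorus (Fin 3))) (x : (UnitAddTorus (Fin 3))) => Literature.MathematicalPhysics.KineticTheory.empiricalMomentumField z (fun y => φ N (y - x)); let ub := fun (N : ℕ) (z : Literature.Analysis.FluidPDE.Config (N + 1) (Fin 3) (UnitAddTorus (Fin 3))) (x : (UnitAddTorus (Fin 3))) => (ρb N z x)⁻¹ • mb N z x; let D := fun (N : ℕ) (z : Literature.Analysis.FluidPDE.Config (N + 1) (Fin 3) (UnitAddTorus (Fin 3))) (x : (UnitAddTorus (Fin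 3))) (j k : Fin 3) => (∫ y, φ N (y.1 - x) * ((y.2 j - ub N z x j) * (y.2 k - ub N z x k)) ∂(Literature.Analysis.FluidPDE.empiricalMeasure z)) - (if j = k then (∑ l : Fin 3, ∫ y, φ N (y.1 - x) * (y.2 l - ub N z x l) ^ 2 ∂(Literature.Analysis.FluidPDE.empiricalMeasure z)) / 3 else 0); let q := fun (N : ℕ) (z : Literature.Analysis.FluidPDE.Config (N + 1) (Fin 3) (UnitAddTorus (Fin 3))) (x : (UnitAddTorus (Fin 3))) => ∫ y, (φ N (y.1 - x) * ‖y.2 - ub N z x‖ ^ 2 / 2) • (y.2 - ub N z x) ∂(Literature.Analysis.FluidPDE.empiricalMeasure z); ∀ t : ℝ, 0 < t → ∀ δ : ℝ, 0 < δ → Tendsto (fun N : ℕ => Literature.MathematicalPhysics.KineticTheory.localGibbsLaw σ a₀ u₀ θ₀ N (Φ N) {z | δ < ∫ s in Icc 0 t, ∫ x, ((∑ j, ∑ k, D N ((Φ N).flow s z) x j k ^ 2) + ‖q N ((Φ N).flow s z) x‖ ^ 2)}) atTop (𝓝 0)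

/-- item stmt-AtomisticToContinuum-7235 · support · rank 9 · closed · moot by None · by planner
sources: ChenLevermoreLiu1994
[support] CollisionalCoercivity → AprioriBounds → FastMomentRelaxation: from (‡), κ(N+1)^(1/3) X ≤
½‖D(0)‖² + ∫∫⟨D, T_free D⟩ + δ with X = ∫₀ᵗ∫|D|²; crude bounds ‖D(0)‖²_(L²ₓ) ≤
C(N+1)^(3γ)·(energy)², sup|D| ≤ C(N+1)^(3γ), ∫ₓ|T_free D| ≤ C(c₁)(N+1)^γ × cubic velocity moment
(kernel gradient in L¹, ρ̄ ≥ c₁ for the ū-derivative), moments from AprioriBounds(i), give X ≤ C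
N^(4γ − 1/3)/κ → 0 for γ ≤ 1/15; same for q with quartic/sextic moments via Cauchy–Schwarz in time.
[deps: CollisionalCoercivity, AprioriBounds, FastMomentRelaxation] [difficulty: M] -/
@[route_item "route-AtomisticToContinuum-StiffRelaxation"]
def CoercivityGlue : Prop :=
  CollisionalCoercivity → AprioriBounds → FastMomentRelaxation

/-- item stmt-AtomisticToContinuum-7236 · support · rank 9 · closed · moot by None · by planner
sources: Ruelle1969, LebowitzPenrose1964, Spohn1991
[support] (statics, low-density cluster expansion; strengthens localGibbs_lln / stmt-0767 to
mesoscopic scale and L²ₓ) for all profiles ∃σ₀ ∀σ<σ₀ ∃ρ₀ continuous > 0 ∀ flows: the local Gibbs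
laws are probability measures and for every admissible kernel family the block fields AT TIME 0
converge in L²(𝕋³) in probability to (ρ₀, ρ₀u₀, ρ₀(|u₀|²/2 + 3θ₀/2)). [difficulty: M] -/
@[route_item "route-AtomisticToContinuum-StiffRelaxation"]
def MesoscopicLLN : Prop :=
  ∀ (a₀ θ₀ : (UnitAddTorus (Fin 3)) → ℝ) (u₀ : (UnitAddTorus (Fin 3)) → (EuclideanSpace ℝ (Fin 3))), Continuous a₀ → Continuous θ₀ → Continuous u₀ → (∀ x, 0 < a₀ x) → (∀ x, 0 < θ₀ x) → ∃ σ₀ : ℝ, 0 < σ₀ ∧ ∀ σ : ℝ, 0 < σ → σ < σ₀ → ∃ ρ₀ : (UnitAddTorus (Fin 3)) → ℝ, Continuous ρ₀ ∧ (∀ x, 0 < ρ₀ x) ∧ ∀ Φ : (N : ℕ) → Literature.Analysis.FluidPDE.HardSphereFlow (Literature.Analysis.FluidPDE.Torus.geometry (Fin 3)) (Literature.MathematicalPhysics.KineticTheory.hsDiameter σ N) (N + 1), (∀ N, IsProbabilityMeasure (Literature.MathematicalPhysics.KineticTheory.localGibbsLaw σ a₀ u₀ θ₀ N (Φ N)))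 ∧ ∀ (γ C : ℝ) (φ : ℕ → (UnitAddTorus (Fin 3)) → ℝ), 0 < γ → γ ≤ 1 / 15 → ((∀ N, Literature.Analysis.FunctionSpaces.Torus.IsSmooth (φ N)) ∧ (∀ N y, 0 ≤ φ N y) ∧ (∀ N, ∫ y, φ N y = 1) ∧ (∀ (N : ℕ) y, ((N : ℝ) + 1) ^ (-γ) ≤ Literature.Analysis.FluidPDE.Torus.euclidDist y 0 → φ N y = 0) ∧ (∀ (N : ℕ) y, φ N y ≤ C * ((N : ℝ) + 1) ^ (3 * γ)) ∧ (∀ (N : ℕ) y, ‖Literature.Analysis.FunctionSpaces.Torus.gradient (φ N) y‖ ≤ C * ((N : ℝ) + 1) ^ (4 * γ))) → ∀ δ : ℝ, 0 < δ → Tendsto (fun N : ℕ => Literature.MathematicalPhysics.KineticTheory.localGibbsLaw σ a₀ u₀ θ₀ N (Φ N) {z | δ < ∫ x, ((Literature.MathematicalPhysics.KineticTheory.empiricalDensityField z (fun y => φ N (y - x)) - ρ₀ x) ^ 2 + ‖Literature.MathematicalPhysics.KineticTheory.empiricalMomentumField z (fun y => φ N (y - x)) - ρ₀ x • u₀ x‖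 ^ 2 + (Literature.MathematicalPhysics.KineticTheory.empiricalEnergyField z (fun y => φ N (y - x)) - Literature.MathematicalPhysics.KineticTheory.totalEnergyDensity (ρ₀ x) (u₀ x) (θ₀ x)) ^ 2)}) atTop (𝓝 0)

/-- item stmt-AtomisticToContinuum-7237 · support · rank 9 · closed · moot by None · by planner
sources: Ruelle1969, LebowitzPenrose1964, Dafermos2005
[support] (statics; strengthens HsEntropyConvex stmt-0817 from strict to strong convexity and adds
C²-regularity, both from HsEosLowDensity stmt-0768: f_ex analytic near 0 with f′(0) = 2π/3 ⇒ (ηZ)′ >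
0 ⇒ positive-definite Hessian) ∃η₀>0: hsExcessFreeEnergy is C² on (0, η₀) and for all σ, c₁ > 0 and
E₁ there is m > 0 with η_σ − m(ρ² + |m|² + E²) convex on {c₁/2 < ρ, ρσ³ < η₀, |m|² < 2ρE, E < E₁}.
[difficulty: M] -/
@[route_item "route-AtomisticToContinuum-StiffRelaxation"]
def HsEntropyUniformlyConvex : Prop :=
  ∃ η₀ : ℝ, 0 < η₀ ∧ ContDiffOn ℝ 2 Literature.MathematicalPhysics.KineticTheory.hsExcessFreeEnergy (Set.Ioo 0 η₀) ∧ ∀ σ c₁ E₁ : ℝ, 0 < σ → 0 < c₁ → ∃ m : ℝ, 0 < m ∧ ConvexOn ℝ {U : ℝ × (EuclideanSpace ℝ (Fin 3)) × ℝ | c₁ / 2 < U.1 ∧ U.1 * σ ^ 3 < η₀ ∧ ‖U.2.1‖ ^ 2 < 2 * U.1 * U.2.2 ∧ U.2.2 < E₁} (fun U : ℝ × (EuclideanSpace ℝ (Fin 3)) × ℝ => -(U.1 * (3 / 2 * Real.log (2 / 3 * (U.2.2 / U.1 - ‖U.2.1‖ ^ 2 / (2 * U.1 ^ 2))) - Real.log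 U.1 - Literature.MathematicalPhysics.KineticTheory.hsExcessFreeEnergy (U.1 * σ ^ 3))) - m * (U.1 ^ 2 + ‖U.2.1‖ ^ 2 + U.2.2 ^ 2))

/-- item stmt-AtomisticToContinuum-7238 · support · rank 9 · closed · moot by None · by planner
sources: Ruelle1969, Dafermos2005
[support] (statics beyond the virial radius: Ruelle convexity of the free-energy density η ↦ η log η
+ η·hsExcessFreeEnergy(η) on (0, 1.1) ⊂ (0, √2), transported to conserved variables by the
perspective lemma; non-strict, phase transition allowed) for every σ > 0, η_σ is convex on {0 < ρ,
ρσ³ < 11/10, |m|² < 2ρE}. [difficulty: M] -/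
@[route_item "route-AtomisticToContinuum-StiffRelaxation"]
def HsFreeEnergyConvex : Prop :=
  ∀ σ : ℝ, 0 < σ → ConvexOn ℝ {U : ℝ × (EuclideanSpace ℝ (Fin 3)) × ℝ | 0 < U.1 ∧ U.1 * σ ^ 3 < 11 / 10 ∧ ‖U.2.1‖ ^ 2 < 2 * U.1 * U.2.2} (fun U : ℝ × (EuclideanSpace ℝ (Fin 3)) × ℝ => -(U.1 * (3 / 2 * Real.log (2 / 3 * (U.2.2 / U.1 - ‖U.2.1‖ ^ 2 / (2 * U.1 ^ 2))) - Real.log U.1 - Literature.MathematicalPhysics.KineticTheory.hsExcessFreeEnergy (U.1 * σ ^ 3))))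

/-- item stmt-AtomisticToContinuum-7239 · support · rank 9 · closed · moot by None · by planner
sources: MerleEtAl2022, Sideris1985, Majda1984
[support] (SHARED LOOPHOLE of the conjunct, isolated: the dilute chamber) for all profiles ∃σ₀, R
∀σ<σ₀: every classical hs-Euler solution on [0,T) whose initial fields are the local-Gibbs limits
(hypothesis TendstoHydroFieldsAt at t = 0 under probability laws) has density ≤ R on [0,T) —
uniformly in σ < σ₀ and in the classical existence time T; true for shock-type first singularities
(bounded density at gradient blow-up, uniform as σ → 0), in doubt for focusing profiles (smooth
self-similar implosion, MerleEtAl2022, is known for γ-laws only; p → ∞ at close packing may arrest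
it); its refutation is a Statement-level finding, not a defeat of the mechanism. [difficulty:
open-problem] -/
@[route_item "route-AtomisticToContinuum-StiffRelaxation"]
def NoImplosion : Prop :=
  ∀ (a₀ θ₀ : (UnitAddTorus (Fin 3)) → ℝ) (u₀ : (UnitAddTorus (Fin 3)) → (EuclideanSpace ℝ (Fin 3))), Continuous a₀ → Continuous θ₀ → Continuous u₀ → (∀ x, 0 < a₀ x) → (∀ x, 0 < θ₀ x) → ∃ σ₀ R : ℝ, 0 < σ₀ ∧ ∀ σ : ℝ, 0 < σ → σ < σ₀ → ∀ (T : ℝ) (ρ θ : ℝ → (UnitAddTorus (Fin 3)) → ℝ) (u : ℝ → (UnitAddTorus (Fin 3)) → (EuclideanSpace ℝ (Fin 3))), Literature.MathematicalPhysics.KineticTheory.IsHardSphereEulerSolution σ T ρ u θ → ∀ Φ : (N : ℕ) → Literature.Analysis.FluidPDE.HardSphereFlow (Literature.Analysis.FluidPDE.Torus.geometry (Fin 3)) (Literature.MathematicalPhysics.KineticTheory.hsDiameter σ N) (N + 1), (∀ N, IsProbabilityMeasure (Literature.MathematicalPhysics.KineticTheory.localGibbsLaw σ a₀ u₀ θ₀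 N (Φ N))) → Literature.MathematicalPhysics.KineticTheory.TendstoHydroFieldsAt (fun N => Literature.MathematicalPhysics.KineticTheory.localGibbsLaw σ a₀ u₀ θ₀ N (Φ N)) Φ ρ u θ 0 → ∀ t ∈ Ico 0 T, ∀ x, ρ t x ≤ R

/-- item stmt-AtomisticToContinuum-7240 · assembly · rank 1 · closed · moot by None · by planner
sources: Dafermos2005, Spohn1991, OllaVaradhanYau1993
[assembly] CoercivityGlue → CollisionalCoercivity → CollisionalTransferLocality → AprioriBounds →
RelEntropyStability → SecondLawInProbability → MesoscopicLLN → HsEntropyUniformlyConvex →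
HsFreeEnergyConvex → NoImplosion → HydrodynamicLimit. -/
@[route_item "route-AtomisticToContinuum-StiffRelaxation"]
def Assembly : Prop :=
  CoercivityGlue → CollisionalCoercivity → CollisionalTransferLocality → AprioriBounds → RelEntropyStability → SecondLawInProbability → MesoscopicLLN → HsEntropyUniformlyConvex → HsFreeEnergyConvex → NoImplosion → Literature.MathematicalPhysics.KineticTheory.HydrodynamicLimit

end Summit.AtomisticToContinuum.HydrodynamicLimit.Theses.StiffRelaxation
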